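import Literature.IUT.HodgeArakelov.GaloisPairCyclotomesThetaSyncGaloisSide
import Literature.AnabelianGeometry.EtaleTheta.Cyclotome
import HarnessLib

/-!
# Bridge B12, `Π`-side at Cor. 1.10's GENUINE family — the [EtTh]-side sentence (E_Θ) «`(l·Δ_Θ)(𝕄_*) ≅ Ẑ(1)` as a
# `G_K`-module» is PROVED; the `Π`-side residual of [IUTchII] Cor. 1.11 (b) at the genuine family is (C) ALONE (proof-only)

Mochizuki, *Inter-universal Teichmüller theory II*, §1, Cor. 1.11 (b), kurims manuscript (Dec. 2020) p. 49 ll. 22–35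
[claim: Mochizuki2012, status: disputed] (IUTchII §1 Cor 1.11, kurims p.49); [EtTh] §1 p. 12 (PRIMS p. 238) "`Δ_Θ (≅ Ẑ(1))`",
Def. 2.13 (ii) p. 48 "the natural isomorphism `μ_N ≅ (l·Δ_Θ) ⊗ (ℤ/Nℤ)`" [cite: MochizukiEtTh2009, §1 p.12]. Record-only typing under
the claim key `Mochizuki2012` (D-0012, disputed); abc-iut cell, layer L6, node `IUTchII:Cor1.11` (B12 `Π`-side) over
`IUTchII:Cor1.10` (abc-iut-w4-d038's genuine family); seat abc-iut-w5-d145 (gen 3); closes GAP-LEDGER row G-w5d145-1.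

STATE BEFORE THIS FILE (`GaloisPairCyclotomesThetaSyncGaloisSide`, p430955): `Nonempty (GalCorPiXInput A familyLim)` ⟺ (E_Θ) ∧ (C),
where (E_Θ) := «∃ t : (l·Δ_Θ)(𝕄_*) ⥲ Λ(ℚ̄_pˣ)` carrying the conjugation action of `x ∈ Π^tp_{X̲̲}` to the Galois action of `aug(x)`».

THIS FILE PROVES (E_Θ) from the genuine family's OWN binders — the compatible cyclotome identifications
`mods M : CyclotomeMod l M` ([EtTh] Def. 2.13 "`μ_N ≅ (l·Δ_Θ) ⊗ ℤ/Nℤ`", `G_K`-equivariant by `red_conj`), `hmods`, and `hZ`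
(through abc-iut-w4-d030's bijectivity of the limit rigidity map, `rigidLimEquiv`) — no new hypothesis:
* `ModelFrame.right_eq_one_of_mem_ker`, `extEquiv_symm_apply`, `coe_reconstruction_extAct` — in abc-iut-L6-d6's model
  reconstruction `Π^tp_Y[μ_N] = μ_N ⋊ Π^tp_Y`, the exterior cyclotome is the `μ_N`-coordinate and the exterior action of `x` on it is
  the cyclotomic character `χ(aug x)` (bookkeeping over `reconstruction_extAct_apply`);
* `EtaleLevels.extCycLim_right_eq_one`, `extCycLim_left_compat`, `actExtLim_left` — coordinates of abc-iut-L6-t1/w4-d030's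
  projective-limit exterior cyclotome `Π_μ(𝕄_*) = lim_M μ_M`: trivial `Π^tp_Y`-coordinate, transitions = power maps
  (`MuN.red`), and the `Π^tp_{X̲̲}`-action acts on the `μ_n`-coordinate by `galMuN (aug x)` — the FIELD action on roots of unity;
* `extCycLim_coord_mem_cyclotome`, `extCycLim_eq_of_coord_eq`, `exists_extCycLim_coord_eq`,
  **`exists_extCycLim_mulEquiv_cyclotome`** — `Π_μ(𝕄_*) ⥲ Λ(ℚ̄_pˣ)` coordinatewise (compatible systems of roots of unity);
* **`exists_thetaSide_equivariant`** — (E_Θ): `(l·Δ_Θ)(𝕄_*) ⥲ Π_μ(𝕄_*) ⥲ Λ(ℚ̄_pˣ)` (`rigidLimEquiv` then coordinates) is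
  `Π^tp_{X̲̲}`-EQUIVARIANT for conjugation vs the Galois action through `aug` — VERBATIM [EtTh] §1 p. 12 "`Δ_Θ (≅ Ẑ(1))`" as a
  `G_K`-module for the tree's `(l·Δ_Θ)(𝕄_*) = (l·Δ_Θ)/thetaKer`, PROVED;
* **`exists_equivariant_iso`** — hence condition (E) of the `Π`-side residual HOLDS at the genuine family: there IS a
  `Π^tp_{X̲̲}`-equivariant isomorphism `μ_Ẑ(Π^tp_{X̲̲}/Δ) ⥲ (l·Δ_Θ)(𝕄_*)` (the genuine Galois side p430955 + (E_Θ));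
* `nonempty_muZhat_Gk_mulEquiv_zHat` (v2, append-only) — «`μ_Ẑ(G_K) ≃* Ẑ`» abstractly (conjunct (1) of p428581's scalar form);
* **`nonempty_galCorPiXInput_familyLim_iff_compatible`** / **`…_iff_exists_compatible`** — THE RESIDUAL: for every Ex. 1.8
  interface `A`, `GalCorPiXInput A familyLim` is inhabited iff EVERY (equivalently SOME) isomorphism
  `μ_Ẑ(Π^tp_{X̲̲}/Δ) ⥲ (l·Δ_Θ)(𝕄_*)` is compatible with the two `Aut(Π^tp_{X̲̲})`-actions `μ_Ẑ(quotMap γ)` / `rhoALim γ`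
  — condition (C) = [AbsTopIII] Cor. 1.10 (c) NATURALITY w.r.t. arbitrary topological automorphisms composed with [EtTh]
  Cor. 2.19 (i) (GAP-LEDGER G-w5d145-2; FACT-LIST F-0348 records Cor. 1.10 (c) as bare existence in the `CurveModel` vocabulary).
HONEST FRAMING: proof-only bookkeeping over typed interfaces and the cell's own [EtTh]-model constructions; (C) is NOT proved
here; nothing here bears on [IUTchIII] Cor. 3.12 and no side is taken; typed ≠ discharged.
-/

noncomputable section

namespace Literature.IUT.HodgeArakelov

open CategoryTheory
open Literature.AnabelianGeometry.AbsoluteAnabelian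

namespace ModelFrame

open scoped Literature.AnabelianGeometry.EtaleTheta

variable {S : ThetaSetting.{0}} {l : ℕ} {R : Literature.AnabelianGeometry.EtaleTheta.RigidData.{0} S.N l}
  (F : ModelFrame S R) {M : MonoThetaEnv S} (e : M.Pi ≃ₜ* R.env)

/-- An element of `Ker(Π_M ↠ Π_Y(M))`, read in the model `Π^tp_Y[μ_N] = μ_N ⋊ Π^tp_Y`, has trivial `Π^tp_Y`-coordinate.
[claim: Mochizuki2012, status: disputed] (IUTchII §1 Def 1.1 (i), kurims p.21) -/
theorem right_eq_one_of_mem_ker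
    (w : ↥((Literature.AnabelianGeometry.EtaleTheta.CycEnvelope.proj R.augY R.chi).comp e.toMulEquiv.toMonoidHom).ker) :
    (e (w : M.Pi) : R.env).right = 1 := by
  have h := w.2
  rw [MonoidHom.mem_ker] at h
  exact h

/-- `extEquiv e` inverted: the `μ_N`-coordinate of `e w` (abc-iut-L6-d6's `μ_N ≃* Ker(Π_M ↠ Π_Y(M))` read backwards).
[claim: Mochizuki2012, status: disputed] (IUTchII §1 Def 1.1 (i), kurims p.21) -/
theorem extEquiv_symm_apply
    (w : ↥((Literature.AnabelianGeometry.EtaleTheta.CycEnvelope.proj R.augY R.chi).comp e.toMulEquiv.toMonoidHom).ker) :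
    (extEquiv e).symm w = (e (w : M.Pi) : R.env).left := by
  apply (extEquiv e).injective
  rw [MulEquiv.apply_symm_apply]
  apply Subtype.ext
  rw [coe_extEquiv]
  apply e.injective
  rw [ContinuousMulEquiv.apply_symm_apply]
  refine SemidirectProduct.ext ?_ ?_
  · rw [SemidirectProduct.left_inl]
  · rw [SemidirectProduct.right_inl, right_eq_one_of_mem_ker]

/-- The exterior action of [IUTchII] Def. 1.1 (i) on `Ker(Π_M ↠ Π_Y(M))`, read in the model: `x ∈ Π^tp_X` acts on the
`μ_N`-coordinate by the cyclotomic character `χ(aug x)` (abc-iut-L6-d6's `reconstruction_extAct_apply` in coordinates).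
[claim: Mochizuki2012, status: disputed] (IUTchII §1 Def 1.1 (i), kurims p.21) -/
theorem coe_reconstruction_extAct (x : R.PiX) (w : ↥(F.reconstruction e).extCyc) :
    (((F.reconstruction e).extAct x w : ↥(F.reconstruction e).extCyc) : M.Pi) =
      e.symm (Literature.AnabelianGeometry.EtaleTheta.CycEnvelope.inMu R.augY R.chi
        (R.chi (R.aug x) (e (w : M.Pi) : R.env).left)) := by
  rw [reconstruction_extAct_apply, coe_extEquiv, extEquiv_symm_apply]

end ModelFrame

namespace EtaleLevels

open Literature.AnabelianGeometry.EtaleTheta Literature.AnabelianGeometry.SemiGraphs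
open scoped Literature.AnabelianGeometry.EtaleTheta

variable {p : ℕ} [Fact p.Prime] {D : Literature.AnabelianGeometry.EtaleTheta.ThetaSetting p}
  {E : D.EtaleThetaData} {l : ℕ} (C : E.DoubleUnderline l) (hC : D.Compat) (hS : D.Sec2Hyps)
  (hl : l.Prime) (hp2 : p ≠ 2) (hpl : p ≠ l) (hζ : ∃ ζ : D.K, IsPrimitiveRoot ζ (4 * l))
  (mods : ∀ M : ℕ+, D.CyclotomeMod l M)
  (f : contCocycles D.toTheta D.DeltaTheta C.GtpYdduu) (hf : f ∈ C.rootCocycles hC)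
  (hmods : ∀ (M M' : ℕ+) (h : (M : ℕ) ∣ (M' : ℕ)) (x : D.lDeltaTheta l),
    MuN.red p M M' h ((mods M').red x) = (mods M).red x)
  (h15 : Literature.AnabelianGeometry.EtaleTheta.ThetaSetting.Prop15iii E hC) (L : C.CuspLabels)
  (hZ : ∀ M : ℕ+, Nonempty (ModelCyclotomes.lDeltaQuot (C.rigidData (mods M) hC hS h15 L) ≃*
    Literature.IUT.HodgeTheaters.ZHat))

/-- Elements of the projective-limit exterior cyclotome `Π_μ(𝕄_*) = lim_M μ_M` ([IUTchII] Prop. 1.5 (iii)) have trivial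
`Π^tp_{Y̲̲}`-coordinate at every level (they lie in `μ_n ⊆ μ_n ⋊ Π^tp_{Y̲̲}`).
[claim: Mochizuki2012, status: disputed] (IUTchII §1 Prop 1.5 (iii), kurims p.29) -/
theorem extCycLim_right_eq_one
    (y : ↥(modelSystem C hC hS hl hp2 hpl hζ mods f hf hmods h15 L hZ).extCycLim) (n : ℕ+) :
    (((y : ∀ M, ((modelSystem C hC hS hl hp2 hpl hζ mods f hf hmods h15 L hZ).env M).Pi) n :
      (levelData C hC hS mods n).env)).right = 1 := by
  have h := y.2.1 n
  rw [MonoidHom.mem_ker] at h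
  exact h

/-- The `μ`-coordinates of an element of `Π_μ(𝕄_*)` are compatible under the power maps `μ_{M'} ↠ μ_M`, `ζ ↦ ζ^{M'/M}`
([EtTh] Def. 2.13 (ii): the transitions of the natural system are `red_{M',M}`). [cite: MochizukiEtTh2009, Def 2.13 (ii) p.48] -/
theorem extCycLim_left_compat
    (y : ↥(modelSystem C hC hS hl hp2 hpl hζ mods f hf hmods h15 L hZ).extCycLim) (M M' : ℕ+)
    (h : (M : ℕ) ∣ (M' : ℕ)) :
    MuN.red p M M' h (((y : ∀ M, ((modelSystem C hC hS hl hp2 hpl hζ mods f hf hmods h15 L hZ).env M).Pi) M' :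
      (levelData C hC hS mods M').env)).left =
      (((y : ∀ M, ((modelSystem C hC hS hl hp2 hpl hζ mods f hf hmods h15 L hZ).env M).Pi) M :
        (levelData C hC hS mods M).env)).left := by
  have h2 := y.2.2 M M' h
  rw [modelSystem_trans] at h2
  rw [← h2, red_left]

/-- **The `Π^tp_{X̲̲}`-action on `Π_μ(𝕄_*)` acts on the `μ_n`-coordinate through the FIELD action of `aug(x) ∈ G_K ≤ Gal(ℚ̄_p/ℚ_p)`
on roots of unity** (`galMuN`): abc-iut-w4-d038's `actExtLim_level` + the model's exterior action in coordinates.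
[claim: Mochizuki2012, status: disputed] (IUTchII §1 Cor 1.10, kurims p.47) -/
theorem actExtLim_left (x : ↥C.Huu)
    (y : ↥(modelSystem C hC hS hl hp2 hpl hζ mods f hf hmods h15 L hZ).extCycLim) (n : ℕ+) :
    (((actExtLim C hC hS hl hp2 hpl hζ mods f hf hmods h15 L hZ x y :
        ↥(modelSystem C hC hS hl hp2 hpl hζ mods f hf hmods h15 L hZ).extCycLim) :
        ∀ M, ((modelSystem C hC hS hl hp2 hpl hζ mods f hf hmods h15 L hZ).env M).Pi) n :
      (levelData C hC hS mods n).env).left =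
      galMuN p n (D.aug (x : D.PiTemp))
        (((y : ∀ M, ((modelSystem C hC hS hl hp2 hpl hζ mods f hf hmods h15 L hZ).env M).Pi) n :
          (levelData C hC hS mods n).env)).left := by
  rw [actExtLim_level]
  have h := congrArg (fun w : ((modelFamily C hC hS hl hp2 hpl hζ mods f hf).modelEnv n).Pi =>
      ((w : (levelData C hC hS mods n).env)).left)
    (ModelFrame.coe_reconstruction_extAct (M := (modelFamily C hC hS hl hp2 hpl hζ mods f hf).modelEnv n)
      (modelFrame C hC hS hl hp2 hpl hζ mods f hf h15 L hZ n) (ContinuousMulEquiv.refl _) x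
      ⟨(y : ∀ M, ((modelSystem C hC hS hl hp2 hpl hζ mods f hf hmods h15 L hZ).env M).Pi) n, y.2.1 n⟩)
  exact h


/-- The `μ`-coordinate family `(ζ_n)_n` of an element of `Π_μ(𝕄_*)` is a compatible system of roots of unity of `ℚ̄_p`, i.e. an
element of `Λ(ℚ̄_pˣ)` (`EtaleTheta.cyclotome`). [claim: Mochizuki2012, status: disputed] (IUTchII §1 Cor 1.11, kurims p.49) -/
theorem extCycLim_coord_mem_cyclotome
    (y : ↥(modelSystem C hC hS hl hp2 hpl hζ mods f hf hmods h15 L hZ).extCycLim) :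
    (fun n : ℕ+ => (((((y : ∀ M, ((modelSystem C hC hS hl hp2 hpl hζ mods f hf hmods h15 L hZ).env M).Pi) n :
        (levelData C hC hS mods n).env)).left : MuN p n) : (PadicAlgCl p)ˣ)) ∈
      Literature.AnabelianGeometry.EtaleTheta.cyclotome (AlgebraicClosure ℚ_[p])ˣ := by
  refine (Literature.AnabelianGeometry.EtaleTheta.cyclotome.mem_iff _).2 ⟨fun n => ?_, fun n m => ?_⟩
  · exact (mem_rootsOfUnity _ _).1 (((y : ∀ M, ((modelSystem C hC hS hl hp2 hpl hζ mods f hf hmods h15 L hZ).env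
      M).Pi) n : (levelData C hC hS mods n).env)).left.2
  · have h := extCycLim_left_compat C hC hS hl hp2 hpl hζ mods f hf hmods h15 L hZ y n (n * m)
      (Dvd.intro _ (PNat.mul_coe n m).symm)
    have h' := congrArg (fun a : MuN p n => (a : (PadicAlgCl p)ˣ)) h
    simp only [MuN.coe_red, PNat.mul_coe, Nat.mul_div_cancel_left _ n.pos] at h'
    exact h'

/-- An element of `Π_μ(𝕄_*)` is determined by its `μ`-coordinates. [claim: Mochizuki2012, status: disputed] (IUTchII §1 Cor 1.11, kurims p.49) -/
theorem extCycLim_eq_of_coord_eq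
    (y z : ↥(modelSystem C hC hS hl hp2 hpl hζ mods f hf hmods h15 L hZ).extCycLim)
    (h : ∀ n : ℕ+, (((y : ∀ M, ((modelSystem C hC hS hl hp2 hpl hζ mods f hf hmods h15 L hZ).env M).Pi) n :
        (levelData C hC hS mods n).env)).left =
      (((z : ∀ M, ((modelSystem C hC hS hl hp2 hpl hζ mods f hf hmods h15 L hZ).env M).Pi) n :
        (levelData C hC hS mods n).env)).left) : y = z := by
  refine Subtype.ext (funext fun n => ?_)
  refine SemidirectProduct.ext (h n) ?_
  rw [extCycLim_right_eq_one, extCycLim_right_eq_one]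

/-- Every compatible system of roots of unity of `ℚ̄_p` is the `μ`-coordinate family of an element of `Π_μ(𝕄_*)` (the family
`(ζ_M ⋊ 1)_M` is compatible under `red_{M',M}`). [claim: Mochizuki2012, status: disputed] (IUTchII §1 Cor 1.11, kurims p.49) -/
theorem exists_extCycLim_coord_eq (ζ : ↥(Literature.AnabelianGeometry.EtaleTheta.cyclotome (AlgebraicClosure ℚ_[p])ˣ)) :
    ∃ y : ↥(modelSystem C hC hS hl hp2 hpl hζ mods f hf hmods h15 L hZ).extCycLim,
      ∀ n : ℕ+, (((((y : ∀ M, ((modelSystem C hC hS hl hp2 hpl hζ mods f hf hmods h15 L hZ).env M).Pi) n :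
        (levelData C hC hS mods n).env)).left : MuN p n) : (PadicAlgCl p)ˣ) = (ζ : ℕ+ → (AlgebraicClosure ℚ_[p])ˣ) n := by
  have hζ' := (Literature.AnabelianGeometry.EtaleTheta.cyclotome.mem_iff _).1 ζ.2
  -- the level-`n` root of unity
  have hmem : ∀ n : ℕ+, (ζ : ℕ+ → (AlgebraicClosure ℚ_[p])ˣ) n ∈ rootsOfUnity n (PadicAlgCl p) := fun n =>
    (mem_rootsOfUnity _ _).2 (hζ'.1 n)
  let w : ∀ M : ℕ+, ((modelSystem C hC hS hl hp2 hpl hζ mods f hf hmods h15 L hZ).env M).Pi := fun M =>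
    (Literature.AnabelianGeometry.EtaleTheta.CycEnvelope.inMu (levelData C hC hS mods M).augY (levelData C hC hS mods M).chi
      ⟨(ζ : ℕ+ → (AlgebraicClosure ℚ_[p])ˣ) M, hmem M⟩ : (levelData C hC hS mods M).env)
  have hw : w ∈ (modelSystem C hC hS hl hp2 hpl hζ mods f hf hmods h15 L hZ).extCycLim := by
    refine ⟨fun M => ?_, fun M M' h => ?_⟩
    · exact MonoidHom.mem_ker.2 rfl
    · rw [modelSystem_trans]
      refine SemidirectProduct.ext ?_ ?_
      · rw [red_left, SemidirectProduct.left_inl, SemidirectProduct.left_inl]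
        apply Subtype.ext
        rw [MuN.coe_red]
        obtain ⟨k, hk⟩ := h
        have hk0 : 0 < k := Nat.pos_of_ne_zero fun h0 => by rw [h0, mul_zero] at hk; exact (PNat.ne_zero M') hk
        have hM' : M' = M * ⟨k, hk0⟩ := PNat.eq hk
        subst hM'
        have hdiv : ((M * ⟨k, hk0⟩ : ℕ+) : ℕ) / (M : ℕ) = k := by
          rw [PNat.mul_coe, PNat.mk_coe, Nat.mul_div_cancel_left _ M.pos]
        rw [hdiv]
        exact hζ'.2 M ⟨k, hk0⟩
      · rw [red_right, SemidirectProduct.right_inl, SemidirectProduct.right_inl]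
  exact ⟨⟨w, hw⟩, fun n => rfl⟩

/-- **`Π_μ(𝕄_*) ⥲ Λ(ℚ̄_pˣ) = Ẑ(1)`, coordinatewise**: the projective-limit exterior cyclotome of [IUTchII] Prop. 1.5 (iii) at the
genuine natural system IS the group of compatible systems of roots of unity of `ℚ̄_p`, by `y ↦ (μ`-coordinate of `y_n)_n`.
[claim: Mochizuki2012, status: disputed] (IUTchII §1 Prop 1.5 (iii), kurims p.29) -/
theorem exists_extCycLim_mulEquiv_cyclotome :
    ∃ Φ : ↥(modelSystem C hC hS hl hp2 hpl hζ mods f hf hmods h15 L hZ).extCycLim ≃*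
        ↥(Literature.AnabelianGeometry.EtaleTheta.cyclotome (AlgebraicClosure ℚ_[p])ˣ),
      ∀ (y : ↥(modelSystem C hC hS hl hp2 hpl hζ mods f hf hmods h15 L hZ).extCycLim) (n : ℕ+),
        ((Φ y : ↥(Literature.AnabelianGeometry.EtaleTheta.cyclotome (AlgebraicClosure ℚ_[p])ˣ)) :
            ℕ+ → (AlgebraicClosure ℚ_[p])ˣ) n =
          (((((y : ∀ M, ((modelSystem C hC hS hl hp2 hpl hζ mods f hf hmods h15 L hZ).env M).Pi) n :
            (levelData C hC hS mods n).env)).left : MuN p n) : (PadicAlgCl p)ˣ) := by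
  let φf : ↥(modelSystem C hC hS hl hp2 hpl hζ mods f hf hmods h15 L hZ).extCycLim →
      ↥(Literature.AnabelianGeometry.EtaleTheta.cyclotome (AlgebraicClosure ℚ_[p])ˣ) := fun y =>
    ⟨fun n : ℕ+ => (((((y : ∀ M, ((modelSystem C hC hS hl hp2 hpl hζ mods f hf hmods h15 L hZ).env M).Pi) n :
        (levelData C hC hS mods n).env)).left : MuN p n) : (PadicAlgCl p)ˣ),
      extCycLim_coord_mem_cyclotome C hC hS hl hp2 hpl hζ mods f hf hmods h15 L hZ y⟩
  have hφf : ∀ y z, φf (y * z) = φf y * φf z := by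
    intro y z
    refine Subtype.ext (funext fun n => ?_)
    change ((((((y * z : ↥(modelSystem C hC hS hl hp2 hpl hζ mods f hf hmods h15 L hZ).extCycLim) : ∀ M,
      ((modelSystem C hC hS hl hp2 hpl hζ mods f hf hmods h15 L hZ).env M).Pi) n :
        (levelData C hC hS mods n).env)).left : MuN p n) : (PadicAlgCl p)ˣ) =
      (((((y : ∀ M, ((modelSystem C hC hS hl hp2 hpl hζ mods f hf hmods h15 L hZ).env M).Pi) n :
        (levelData C hC hS mods n).env)).left : MuN p n) : (PadicAlgCl p)ˣ) *
      (((((z : ∀ M, ((modelSystem C hC hS hl hp2 hpl hζ mods f hf hmods h15 L hZ).env M).Pi) n :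
        (levelData C hC hS mods n).env)).left : MuN p n) : (PadicAlgCl p)ˣ)
    have key : ((((y * z : ↥(modelSystem C hC hS hl hp2 hpl hζ mods f hf hmods h15 L hZ).extCycLim) : ∀ M,
        ((modelSystem C hC hS hl hp2 hpl hζ mods f hf hmods h15 L hZ).env M).Pi) n : (levelData C hC hS mods n).env)).left =
      (((y : ∀ M, ((modelSystem C hC hS hl hp2 hpl hζ mods f hf hmods h15 L hZ).env M).Pi) n :
          (levelData C hC hS mods n).env)).left *
        (((z : ∀ M, ((modelSystem C hC hS hl hp2 hpl hζ mods f hf hmods h15 L hZ).env M).Pi) n :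
          (levelData C hC hS mods n).env)).left := by
      have h := SemidirectProduct.mul_left
        (((y : ∀ M, ((modelSystem C hC hS hl hp2 hpl hζ mods f hf hmods h15 L hZ).env M).Pi) n :
          (levelData C hC hS mods n).env))
        (((z : ∀ M, ((modelSystem C hC hS hl hp2 hpl hζ mods f hf hmods h15 L hZ).env M).Pi) n :
          (levelData C hC hS mods n).env))
      rw [extCycLim_right_eq_one, map_one, MulAut.one_apply] at h
      exact h
    rw [key, Subgroup.coe_mul]
  let φ : ↥(modelSystem C hC hS hl hp2 hpl hζ mods f hf hmods h15 L hZ).extCycLim →*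
      ↥(Literature.AnabelianGeometry.EtaleTheta.cyclotome (AlgebraicClosure ℚ_[p])ˣ) := MonoidHom.mk' φf hφf
  have hφ : ∀ y n, ((φ y : ↥(Literature.AnabelianGeometry.EtaleTheta.cyclotome (AlgebraicClosure ℚ_[p])ˣ)) :
      ℕ+ → (AlgebraicClosure ℚ_[p])ˣ) n =
        (((((y : ∀ M, ((modelSystem C hC hS hl hp2 hpl hζ mods f hf hmods h15 L hZ).env M).Pi) n :
          (levelData C hC hS mods n).env)).left : MuN p n) : (PadicAlgCl p)ˣ) := fun _ _ => rfl
  have hinj : Function.Injective φ := fun y z hyz =>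
    extCycLim_eq_of_coord_eq C hC hS hl hp2 hpl hζ mods f hf hmods h15 L hZ y z fun n =>
      Subtype.ext (Units.ext (by
        have := congrArg (fun ξ : ↥(Literature.AnabelianGeometry.EtaleTheta.cyclotome (AlgebraicClosure ℚ_[p])ˣ) =>
          (((ξ : ℕ+ → (AlgebraicClosure ℚ_[p])ˣ) n : (AlgebraicClosure ℚ_[p])ˣ) : AlgebraicClosure ℚ_[p])) hyz
        exact this))
  have hsurj : Function.Surjective φ := fun ζ => by
    obtain ⟨y, hy⟩ := exists_extCycLim_coord_eq C hC hS hl hp2 hpl hζ mods f hf hmods h15 L hZ ζ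
    exact ⟨y, Subtype.ext (funext fun n => hy n)⟩
  exact ⟨MulEquiv.ofBijective φ ⟨hinj, hsurj⟩, hφ⟩


/-- **(E_Θ) PROVED — «`(l·Δ_Θ)(𝕄_*) ≅ Ẑ(1)` AS A `G_K`-MODULE»** ([EtTh] §1 p. 12 "`Δ_Θ (≅ Ẑ(1))`", for the tree's
`(l·Δ_Θ)(𝕄_*) = (l·Δ_Θ)/thetaKer`): the composite `(l·Δ_Θ)(𝕄_*) ⥲ Π_μ(𝕄_*) ⥲ Λ(ℚ̄_pˣ)` (abc-iut-w4-d030/w4-d038's limit cyclotomic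
rigidity isomorphism `rigidLimEquiv`, then `μ`-coordinates) carries the conjugation action `actA` of `x ∈ Π^tp_{X̲̲}` to the
field action of `aug(x) ∈ G_K` on roots of unity. From the family's own binders (`mods`/`hmods`/`hZ`); no new hypothesis.
This is the [EtTh]-side half of the `Π`-side residual of [IUTchII] Cor. 1.11 (b) (GAP-LEDGER G-w5d145-1), now a theorem.
[claim: Mochizuki2012, status: disputed] (IUTchII §1 Cor 1.11, kurims p.49) -/
theorem exists_thetaSide_equivariant (h218i₁ : (levelRigid C hC hS mods h15 L 1).Cor218_i) :
    ∃ t : ↥(baseDatumLim C hC hS hl hp2 hpl hζ mods f hf hmods h15 L hZ h218i₁).A ≃*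
        ↥(Literature.AnabelianGeometry.EtaleTheta.cyclotome (AlgebraicClosure ℚ_[p])ˣ),
      ∀ (x : (basePointLim C hC hS hl hp2 hpl hζ mods f hf hmods h15 L hZ).G)
          (m : ↥(baseDatumLim C hC hS hl hp2 hpl hζ mods f hf hmods h15 L hZ h218i₁).A) (n : ℕ+),
        ((((t ((baseDatumLim C hC hS hl hp2 hpl hζ mods f hf hmods h15 L hZ h218i₁).actA x m) :
            ↥(Literature.AnabelianGeometry.EtaleTheta.cyclotome (AlgebraicClosure ℚ_[p])ˣ)) :
            ℕ+ → (AlgebraicClosure ℚ_[p])ˣ) n : (AlgebraicClosure ℚ_[p])ˣ) : AlgebraicClosure ℚ_[p]) =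
          (D.aug (Subtype.val x))
            ((((t m : ↥(Literature.AnabelianGeometry.EtaleTheta.cyclotome (AlgebraicClosure ℚ_[p])ˣ)) :
              ℕ+ → (AlgebraicClosure ℚ_[p])ˣ) n : (AlgebraicClosure ℚ_[p])ˣ) : AlgebraicClosure ℚ_[p]) := by
  obtain ⟨Φ, hΦ⟩ := exists_extCycLim_mulEquiv_cyclotome C hC hS hl hp2 hpl hζ mods f hf hmods h15 L hZ
  refine ⟨(rigidLimEquiv C hC hS hl hp2 hpl hζ mods f hf hmods h15 L hZ).trans Φ, fun x m n => ?_⟩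
  have h1 : rigidLimEquiv C hC hS hl hp2 hpl hζ mods f hf hmods h15 L hZ
        ((baseDatumLim C hC hS hl hp2 hpl hζ mods f hf hmods h15 L hZ h218i₁).actA x m) =
      actExtLim C hC hS hl hp2 hpl hζ mods f hf hmods h15 L hZ x (rigidLimEquiv C hC hS hl hp2 hpl hζ mods f hf hmods h15 L hZ m) := by
    rw [actExtLim_apply, MulEquiv.symm_apply_apply]
    rfl
  change ((((Φ (rigidLimEquiv C hC hS hl hp2 hpl hζ mods f hf hmods h15 L hZ
      ((baseDatumLim C hC hS hl hp2 hpl hζ mods f hf hmods h15 L hZ h218i₁).actA x m)) :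
        ↥(Literature.AnabelianGeometry.EtaleTheta.cyclotome (AlgebraicClosure ℚ_[p])ˣ)) :
        ℕ+ → (AlgebraicClosure ℚ_[p])ˣ) n : (AlgebraicClosure ℚ_[p])ˣ) : AlgebraicClosure ℚ_[p]) =
    (D.aug (Subtype.val x))
      ((((Φ (rigidLimEquiv C hC hS hl hp2 hpl hζ mods f hf hmods h15 L hZ m) :
        ↥(Literature.AnabelianGeometry.EtaleTheta.cyclotome (AlgebraicClosure ℚ_[p])ˣ)) :
        ℕ+ → (AlgebraicClosure ℚ_[p])ˣ) n : (AlgebraicClosure ℚ_[p])ˣ) : AlgebraicClosure ℚ_[p])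
  rw [h1, hΦ, hΦ, actExtLim_left, galMuN_apply_coe]

/-- **Condition (E) HOLDS at the genuine natural system**: for every Ex. 1.8 interface `A` there IS a `Π^tp_{X̲̲}`-equivariant
isomorphism `μ_Ẑ(Π^tp_{X̲̲}/Δ) ⥲ (l·Δ_Θ)(𝕄_*)` between the group-theoretic cyclotome of [IUTchII] Cor. 1.11 (b) (cyclotomic character)
and Cor. 1.10's interior cyclotome (conjugation) — the Galois side (p430955: canonical `Π/Δ ⥲ G_K`, LCFT at `ℚ_p`, open-subgroup
equivariance) composed with (E_Θ). [claim: Mochizuki2012, status: disputed] (IUTchII §1 Cor 1.11, kurims p.49) -/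
theorem exists_equivariant_iso (h218i₁ : (levelRigid C hC hS mods h15 L 1).Cor218_i)
    [CompactSpace (setting C hC hS hl hp2 hpl hζ mods f hf).Gk] (A : AbsTopMonoids (setting C hC hS hl hp2 hpl hζ mods f hf)) :
    ∃ c : ↥(A.quotObj (basePointLim C hC hS hl hp2 hpl hζ mods f hf hmods h15 L hZ)).galCyclotome ≃*
        (baseDatumLim C hC hS hl hp2 hpl hζ mods f hf hmods h15 L hZ h218i₁).A,
      ∀ (x : (basePointLim C hC hS hl hp2 hpl hζ mods f hf hmods h15 L hZ).G)
          (ζ : (A.quotObj (basePointLim C hC hS hl hp2 hpl hζ mods f hf hmods h15 L hZ)).galCyclotome),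
        c (haveI := (A.quotObj (basePointLim C hC hS hl hp2 hpl hζ mods f hf hmods h15 L hZ)).compactSpace_carrier;
            (QuotientGroup.mk x : _ ⧸ A.Delta _) • ζ) =
          (baseDatumLim C hC hS hl hp2 hpl hζ mods f hf hmods h15 L hZ h218i₁).actA x (c ζ) :=
  (equivariant_iff_thetaSide C hC hS hl hp2 hpl hζ mods f hf hmods h15 L hZ h218i₁ A).2
    (exists_thetaSide_equivariant C hC hS hl hp2 hpl hζ mods f hf hmods h15 L hZ h218i₁)

/-- **THE `Π`-SIDE RESIDUAL OF [IUTchII] Cor. 1.11 (b) AT Cor. 1.10's GENUINE FAMILY IS (C) ALONE**: for every Ex. 1.8 interface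
`A`, `GalCorPiXInput A familyLim` is inhabited iff EVERY isomorphism `c : μ_Ẑ(Π^tp_{X̲̲}/Δ) ⥲ (l·Δ_Θ)(𝕄_*)` intertwines, for every
topological automorphism `γ` of `Π^tp_{X̲̲}`, the transport `μ_Ẑ(quotMap γ)` with `ρ_A(γ) = rhoALim γ` — i.e. [AbsTopIII]
Cor. 1.10 (c) NATURALITY («the natural isomorphism `μ_Ẑ(G_k) ⥲ μ_Ẑ(Π_X)`», functorial in arbitrary isomorphisms of topological
groups) composed with [EtTh] Cor. 2.19 (i) (GAP-LEDGER G-w5d145-2; FACT-LIST F-0348 is bare existence in the `CurveModel`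
vocabulary). [claim: Mochizuki2012, status: disputed] (IUTchII §1 Cor 1.11, kurims p.49) -/
theorem nonempty_galCorPiXInput_familyLim_iff_compatible (h218i₁ : (levelRigid C hC hS mods h15 L 1).Cor218_i)
    [CompactSpace (setting C hC hS hl hp2 hpl hζ mods f hf).Gk] (A : AbsTopMonoids (setting C hC hS hl hp2 hpl hζ mods f hf)) :
    Nonempty (GalCorPiXInput A (familyLim C hC hS hl hp2 hpl hζ mods f hf hmods h15 L hZ h218i₁)) ↔
      ∀ (c : ↥(A.quotObj (basePointLim C hC hS hl hp2 hpl hζ mods f hf hmods h15 L hZ)).galCyclotome ≃*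
          (baseDatumLim C hC hS hl hp2 hpl hζ mods f hf hmods h15 L hZ h218i₁).A)
        (γ : basePointLim C hC hS hl hp2 hpl hζ mods f hf hmods h15 L hZ ⟶
              basePointLim C hC hS hl hp2 hpl hζ mods f hf hmods h15 L hZ)
        (ζ : (A.quotObj (basePointLim C hC hS hl hp2 hpl hζ mods f hf hmods h15 L hZ)).galCyclotome),
        c (IsoClass.galCyclotomeMap (A.quotMap γ) ζ) =
          (baseDatumLim C hC hS hl hp2 hpl hζ mods f hf hmods h15 L hZ h218i₁).rhoA (IsoClass.homIso γ) (c ζ) := by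
  rw [nonempty_galCorPiXInput_familyLim_iff_thetaSide C hC hS hl hp2 hpl hζ mods f hf hmods h15 L hZ h218i₁ A]
  exact ⟨fun h => h.2, fun h => ⟨exists_thetaSide_equivariant C hC hS hl hp2 hpl hζ mods f hf hmods h15 L hZ h218i₁, h⟩⟩

/-- The same residual tested on ANY ONE isomorphism: `GalCorPiXInput A familyLim` is inhabited iff SOME isomorphism
`μ_Ẑ(Π^tp_{X̲̲}/Δ) ⥲ (l·Δ_Θ)(𝕄_*)` is `Aut(Π^tp_{X̲̲})`-compatible ((C) does not depend on the isomorphism, p428581).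
[claim: Mochizuki2012, status: disputed] (IUTchII §1 Cor 1.11, kurims p.49) -/
theorem nonempty_galCorPiXInput_familyLim_iff_exists_compatible (h218i₁ : (levelRigid C hC hS mods h15 L 1).Cor218_i)
    [CompactSpace (setting C hC hS hl hp2 hpl hζ mods f hf).Gk] (A : AbsTopMonoids (setting C hC hS hl hp2 hpl hζ mods f hf)) :
    Nonempty (GalCorPiXInput A (familyLim C hC hS hl hp2 hpl hζ mods f hf hmods h15 L hZ h218i₁)) ↔
      ∃ c : ↥(A.quotObj (basePointLim C hC hS hl hp2 hpl hζ mods f hf hmods h15 L hZ)).galCyclotome ≃*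
          (baseDatumLim C hC hS hl hp2 hpl hζ mods f hf hmods h15 L hZ h218i₁).A,
        ∀ (γ : basePointLim C hC hS hl hp2 hpl hζ mods f hf hmods h15 L hZ ⟶
              basePointLim C hC hS hl hp2 hpl hζ mods f hf hmods h15 L hZ)
          (ζ : (A.quotObj (basePointLim C hC hS hl hp2 hpl hζ mods f hf hmods h15 L hZ)).galCyclotome),
          c (IsoClass.galCyclotomeMap (A.quotMap γ) ζ) =
            (baseDatumLim C hC hS hl hp2 hpl hζ mods f hf hmods h15 L hZ h218i₁).rhoA (IsoClass.homIso γ) (c ζ) := by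
  have hA := nonempty_baseDatumLim_A_mulEquiv_zHat C hC hS hl hp2 hpl hζ mods f hf hmods h15 L hZ h218i₁
  obtain ⟨c₀, -⟩ := exists_equivariant_iso C hC hS hl hp2 hpl hζ mods f hf hmods h15 L hZ h218i₁ A
  rw [nonempty_galCorPiXInput_familyLim_iff_compatible C hC hS hl hp2 hpl hζ mods f hf hmods h15 L hZ h218i₁ A]
  exact ⟨fun h => ⟨c₀, h c₀⟩, fun ⟨c, hc⟩ c' => GalCorPiXInput.compatible_transfer A _ hA c c' hc⟩

/-! ### v2 (append-only): the abstract-isomorphism conjunct «`μ_Ẑ(G_K) ≃* Ẑ`» is now a theorem -/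

include hmods hZ in
/-- **«`μ_Ẑ(G_K) ≅ Ẑ` as abstract groups» at the genuine setting** ([AbsTopIII] Cor. 1.10 (i)(a); conjunct (1) of the scalar
form `EtaleLevels.nonempty_galCyclotome_basePointLim_iff`, p428581): the group-theoretic cyclotome of the genuine `G_K` is
abstractly `Ẑ` — through the equivariant isomorphism of `exists_equivariant_iso` with `(l·Δ_Θ)(𝕄_*)` and the binder `hZ`.
[claim: Mochizuki2012, status: disputed] (IUTchII §1 Cor 1.11, kurims p.49) -/
theorem nonempty_muZhat_Gk_mulEquiv_zHat (h218i₁ : (levelRigid C hC hS mods h15 L 1).Cor218_i)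
    [CompactSpace (setting C hC hS hl hp2 hpl hζ mods f hf).Gk] (A : AbsTopMonoids (setting C hC hS hl hp2 hpl hζ mods f hf)) :
    Nonempty (↥(muZhat (setting C hC hS hl hp2 hpl hζ mods f hf).Gk) ≃* Literature.IUT.HodgeTheaters.ZHat) := by
  obtain ⟨c, -⟩ := exists_equivariant_iso C hC hS hl hp2 hpl hζ mods f hf hmods h15 L hZ h218i₁ A
  exact (nonempty_galCyclotome_basePointLim_iff C hC hS hl hp2 hpl hζ mods f hf hmods h15 L hZ h218i₁ A).1 ⟨c⟩


end EtaleLevels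
end Literature.IUT.HodgeArakelov
end
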